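import Literature.Analysis.FunctionSpaces.UniformRandomWalkDensityProofs
import Literature.Analysis.FunctionSpaces.UniformRandomWalkDensityPlane
import Literature.Probability.Distributions.CharFunInversion
import HarnessLib

/-!
# Short uniform random walks: `∫₀^∞ t J₀(t)⁵ dt = 2π f_{S₅}(0)`, and Kluyver's formula, `n ≥ 5`

Third sibling file of `Literature/Analysis/FunctionSpaces/UniformRandomWalkDensity.lean`.
Borwein–Straub–Wan–Zudilin [BorweinEtAl2012, §5] read Kluyver's number
`pearsonDensityFourAtOne = ∫₀^∞ t J₀(t)⁵ dt` as `r_{5,0} = p₅'(0) = p₄(1)`: the residue of `W₅` at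
`−2`, the slope at `0` of the radial density `p₅` of the 5-step walk, the value at `1` of `p₄`.
Here the middle reading is made rigorous in density form, by Fourier inversion in the plane:

* `integrable_charFun_uniformWalkLaw_five` — `charFun (uniformWalkLaw 5) = J₀(‖ξ‖)⁵` is
  Lebesgue-integrable on `ℂ ≅ ℝ²` (`UniformRandomWalkDensityPlane`: the characteristic function;
  `UniformRandomWalkDensityProofs`: `t J₀(t)⁵ ∈ L¹(0,∞)`; polar coordinates);
* `uniformWalkLaw_five_eq_withDensity` — hence (`Literature.Probability.Distributions.
  eq_withDensity_fourierDensity_of_integrable_charFun`, the inversion theorem for finite measures)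
  the endpoint `S₅` of the 5-step uniform planar walk has the continuous, non-negative density
  `f₅ = fourierDensity (uniformWalkLaw 5)` with respect to Lebesgue measure;
* `fourierDensity_uniformWalkLaw_five_zero` — and `f₅(0) = pearsonDensityFourAtOne / (2π)`,
  i.e. `∫₀^∞ t J₀(t)⁵ dt = 2π f₅(0)` (`pearsonDensityFourAtOne_eq_two_pi_mul_fourierDensity`).
  Since the radial density is `p₅(x) = x ∫₀^{2π} f₅(x e^{iθ}) dθ`, this is the source's
  `r_{5,0} = p₅'(0)`.

* `fourierDensity_uniformWalkLaw_eq` — **Kluyver's representation (2.1) for `n ≥ 5`**: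
  `f_n(z) = (2π)⁻¹ ∫₀^∞ r J₀(r‖z‖) J₀(r)ⁿ dr` for every `z` (inversion formula, polar coordinates
  in the frequency plane, the angular integral being `2π J₀(r‖z‖)` again), i.e. with
  `p_n(x) := 2πx f_n(x)`: `p_n(x) = ∫₀^∞ x t J₀(xt) J₀(t)ⁿ dt`
  (`two_pi_mul_mul_fourierDensity_uniformWalkLaw`); for general `n ≥ 5` the law of `S_n` is
  `f_n · Lebesgue` with `f_n` continuous (`uniformWalkLaw_eq_withDensity`), `f_n` is radial, and
  the law of the distance `|S_n|` is `p_n(x) dx = 2πx f_n(x) dx` on `(0, ∞)`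
  (`map_norm_uniformWalkLaw`) — together: Kluyver's theorem as quoted in the source, for `n ≥ 5`.

What is NOT here: the cases `2 ≤ n ≤ 4` of (2.1) (conditionally convergent Bessel integrals),
`p₅'(0) = p₄(1)` (continuity of the 4-step density on the unit circle), and the evaluation
`BorweinStraubWanZudilin2012_thm9` itself (modular parametrisation of `p₄` and Chowla–Selberg),
which stays a named fact.

## References

* [BorweinEtAl2012] J. M. Borwein, A. Straub, J. Wan, W. Zudilin, Densities of short uniform random
  walks, Canad. J. Math. 64 (2012) 961–990 = arXiv:1103.2995, §2 eq. (2.1), §5 (the paragraph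
  before Theorem 9: `Res_{−2} W_{n+1} = p'_{n+1}(0) = p_n(1)`).
-/

noncomputable section

open _root_.MeasureTheory _root_.Set _root_.Real _root_.Complex
open scoped ENNReal RealInnerProductSpace ProbabilityTheory
open Literature.Probability.Distributions

namespace Literature.Analysis.FunctionSpaces

/-- The characteristic function `J₀(‖ξ‖)⁵` of `S₅` is Lebesgue-integrable on the plane
(`t J₀(t)⁵` is integrable on `(0,∞)`, polar coordinates). [folklore] -/
theorem integrable_charFun_uniformWalkLaw_five : Integrable (charFun (uniformWalkLaw 5)) := by
  have h2 : Integrable (fun ξ : ℂ => besselJ 0 ‖ξ‖ ^ 5) := by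
    refine (integrable_fun_norm_addHaar (volume : Measure ℂ)
      (f := fun t : ℝ => besselJ 0 t ^ 5)).2 ?_
    simp only [Complex.finrank_real_complex, Nat.add_one_sub_one, pow_one, smul_eq_mul]
    exact integrableOn_mul_besselJ_zero_pow_five
  have h1 : charFun (uniformWalkLaw 5) = fun ξ : ℂ => ((besselJ 0 ‖ξ‖ ^ 5 : ℝ) : ℂ) := by
    funext ξ; rw [charFun_uniformWalkLaw]; push_cast; rfl
  rw [h1]
  exact h2.ofReal

/-- For `n ≥ 5` steps the characteristic function `J₀(‖ξ‖)ⁿ` of `S_n` is integrable as well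
(`|J₀| ≤ 1`). [folklore] -/
theorem integrable_charFun_uniformWalkLaw {n : ℕ} (hn : 5 ≤ n) :
    Integrable (charFun (uniformWalkLaw n)) := by
  refine integrable_charFun_uniformWalkLaw_five.mono
    stronglyMeasurable_charFun.aestronglyMeasurable (Filter.Eventually.of_forall fun ξ => ?_)
  rw [charFun_uniformWalkLaw, charFun_uniformWalkLaw, norm_pow, norm_pow]
  refine pow_le_pow_of_le_one (norm_nonneg _) ?_ hn
  rw [Complex.norm_real, Real.norm_eq_abs]
  exact abs_besselJ_zero_le_one_holds _

/-- **Kluyver's theorem in density form, `n ≥ 5`**: the endpoint `S_n` of the `n`-step uniform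
planar walk has the continuous non-negative density `fourierDensity (uniformWalkLaw n)` (Fourier
inversion of `J₀(‖ξ‖)ⁿ ∈ L¹`). [cite: BorweinEtAl2012, §2 eq. (2.1)] -/
theorem uniformWalkLaw_eq_withDensity {n : ℕ} (hn : 5 ≤ n) :
    uniformWalkLaw n = volume.withDensity
      (fun z => ENNReal.ofReal (fourierDensity (uniformWalkLaw n) z)) :=
  eq_withDensity_fourierDensity_of_integrable_charFun (integrable_charFun_uniformWalkLaw hn)

/-- The density of `S_n`, `n ≥ 5`, is continuous. [folklore] -/
theorem continuous_fourierDensity_uniformWalkLaw {n : ℕ} (hn : 5 ≤ n) :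
    Continuous (fourierDensity (uniformWalkLaw n)) :=
  continuous_fourierDensity (integrable_charFun_iff.1 (integrable_charFun_uniformWalkLaw hn))

/-- **`S₅` has a continuous density**: the law of the endpoint of the 5-step uniform planar walk
is `f₅ · Lebesgue` with `f₅ = fourierDensity (uniformWalkLaw 5)` — continuous
(`continuous_fourierDensity`), non-negative and integrable — by Fourier inversion, since
`charFun (uniformWalkLaw 5) = J₀(‖ξ‖)⁵ ∈ L¹`. [folklore] -/
theorem uniformWalkLaw_five_eq_withDensity :
    uniformWalkLaw 5 = volume.withDensity
      (fun z => ENNReal.ofReal (fourierDensity (uniformWalkLaw 5) z)) :=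
  eq_withDensity_fourierDensity_of_integrable_charFun integrable_charFun_uniformWalkLaw_five

/-- The density `f₅` of `S₅` is continuous. [folklore] -/
theorem continuous_fourierDensity_uniformWalkLaw_five :
    Continuous (fourierDensity (uniformWalkLaw 5)) :=
  continuous_fourierDensity (integrable_charFun_iff.1 integrable_charFun_uniformWalkLaw_five)

/-- **Kluyver's number is `2π ×` the density of `S₅` at the origin**:
`f₅(0) = pearsonDensityFourAtOne / (2π)`, i.e. `∫₀^∞ t J₀(t)⁵ dt = 2π f₅(0)` — the density form
of `r_{5,0} = p₅'(0)` of [BorweinEtAl2012, §5] (`f₅(0) = (2π)^{−2} ∫_ℂ J₀(‖ξ‖)⁵ dξ` by the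
inversion formula, `= (2π)^{−2} · 2π · pearsonDensityFourAtOne` by polar coordinates).
[cite: BorweinEtAl2012, §5] -/
theorem fourierDensity_uniformWalkLaw_five_zero :
    fourierDensity (uniformWalkLaw 5) 0 = pearsonDensityFourAtOne / (2 * π) := by
  rw [fourierDensity_zero integrable_charFun_uniformWalkLaw_five, Complex.finrank_real_complex]
  have h1 : (fun t : ℂ => (charFun (uniformWalkLaw 5) t).re) = fun t : ℂ => besselJ 0 ‖t‖ ^ 5 := by
    funext t; rw [charFun_uniformWalkLaw]; norm_cast
  rw [h1, integral_besselJ_zero_norm_pow_five]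
  field_simp

/-- Equivalently `pearsonDensityFourAtOne = 2π · f₅(0)`. [cite: BorweinEtAl2012, §5] -/
theorem pearsonDensityFourAtOne_eq_two_pi_mul_fourierDensity :
    pearsonDensityFourAtOne = 2 * π * fourierDensity (uniformWalkLaw 5) 0 := by
  rw [fourierDensity_uniformWalkLaw_five_zero]; field_simp

/-! ## Kluyver's Bessel representation (2.1) for `n ≥ 5` -/

/-- Pointwise form of the polar-coordinate integrand. [folklore] -/
private theorem polar_integrand_eq (z : ℂ) (n : ℕ) {p : ℝ × ℝ} (hp : 0 < p.1) :
    p.1 • (cexp (-((⟪(p.1 : ℂ) * (Real.cos p.2 + Real.sin p.2 * I), z⟫ : ℝ) : ℂ) * I) *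
        ((besselJ 0 ‖(p.1 : ℂ) * (Real.cos p.2 + Real.sin p.2 * I)‖ : ℂ) ^ n)) =
      ((p.1 * besselJ 0 p.1 ^ n : ℝ) : ℂ) *
        cexp (I * (((-(p.1 : ℂ) * z).re * Real.cos p.2 + (-(p.1 : ℂ) * z).im * Real.sin p.2 :
          ℝ) : ℂ)) := by
  have hnorm : ‖(p.1 : ℂ) * (Real.cos p.2 + Real.sin p.2 * I)‖ = p.1 := by
    rw [norm_mul, Complex.norm_real, Real.norm_of_nonneg hp.le, Complex.ofReal_cos,
      Complex.ofReal_sin, Complex.norm_cos_add_sin_mul_I, mul_one]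
  have hinner : (⟪(p.1 : ℂ) * (Real.cos p.2 + Real.sin p.2 * I), z⟫ : ℝ) =
      p.1 * (z.re * Real.cos p.2 + z.im * Real.sin p.2) := by
    simp only [Complex.inner, map_mul, Complex.conj_ofReal, map_add, Complex.conj_I,
      Complex.mul_re, Complex.mul_im, Complex.ofReal_re, Complex.ofReal_im, Complex.add_re,
      Complex.add_im, Complex.neg_re, Complex.neg_im, Complex.I_re, Complex.I_im, mul_neg,
      mul_zero, mul_one, zero_mul, sub_zero, add_zero, zero_add, neg_zero, sub_neg_eq_add]
    ring
  rw [hnorm, hinner, Complex.real_smul]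
  have h2 : ((-(p.1 : ℂ) * z).re * Real.cos p.2 + (-(p.1 : ℂ) * z).im * Real.sin p.2 : ℝ) =
      -(p.1 * (z.re * Real.cos p.2 + z.im * Real.sin p.2)) := by
    simp only [neg_mul, Complex.neg_re, Complex.neg_im, Complex.mul_re, Complex.mul_im,
      Complex.ofReal_re, Complex.ofReal_im, zero_mul, sub_zero, add_zero]
    ring
  rw [h2]
  push_cast
  ring_nf

/-- The angular integral: `∫_{(−π,π)} e^{i(a cos θ + b sin θ)} dθ = 2π J₀(‖ξ‖)` for
`ξ = a + bi` (periodic shift of `integral_cexp_I_mul_inner_unitStep`). [folklore] -/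
theorem setIntegral_Ioo_cexp_I_mul_inner (ξ : ℂ) :
    ∫ θ in Ioo (-π) π, cexp (I * ((ξ.re * Real.cos θ + ξ.im * Real.sin θ : ℝ) : ℂ)) =
      2 * π * besselJ 0 ‖ξ‖ := by
  set F : ℝ → ℂ := fun θ => cexp (I * ((ξ.re * Real.cos θ + ξ.im * Real.sin θ : ℝ) : ℂ)) with hF
  have hper : Function.Periodic F (2 * π) := fun θ => by
    simp only [hF, Real.cos_add_two_pi, Real.sin_add_two_pi]
  rw [← integral_Ioc_eq_integral_Ioo, ← intervalIntegral.integral_of_le (by linarith [pi_pos])]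
  have h := hper.intervalIntegral_add_eq (-π) 0
  rw [zero_add, show -π + 2 * π = π by ring] at h
  change ∫ θ in (-π)..π, F θ = _
  rw [h]
  exact integral_cexp_I_mul_inner_unitStep ξ

/-- **Kluyver's formula in density form (`n ≥ 5`)**: for every `z`,
`f_n(z) = (2π)⁻¹ ∫₀^∞ r J₀(r‖z‖) J₀(r)ⁿ dr`; equivalently the radial density of `|S_n|` is
`p_n(x) = 2πx f_n(x) = ∫₀^∞ x t J₀(xt) J₀(t)ⁿ dt` — [BorweinEtAl2012, eq. (2.1)] (Kluyver 1906),
here for `n ≥ 5`, where the Bessel integral converges absolutely.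
[cite: BorweinEtAl2012, §2 eq. (2.1)] -/
theorem fourierDensity_uniformWalkLaw_eq {n : ℕ} (hn : 5 ≤ n) (z : ℂ) :
    fourierDensity (uniformWalkLaw n) z =
      (2 * π)⁻¹ * ∫ r in Ioi (0 : ℝ), r * besselJ 0 (r * ‖z‖) * besselJ 0 r ^ n := by
  rw [fourierDensity_eq_integral_charFun, Complex.finrank_real_complex]
  -- integrability of the radial majorant
  have hrad : IntegrableOn (fun r : ℝ => r * besselJ 0 r ^ n) (Ioi 0) := by
    refine Integrable.mono integrableOn_mul_besselJ_zero_pow_five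
      ((continuous_id.mul ((continuous_besselJ_holds 0).pow n)).aestronglyMeasurable)
      (ae_restrict_of_forall_mem measurableSet_Ioi fun r (hr : 0 < r) => ?_)
    rw [norm_mul, norm_mul, norm_pow, norm_pow, Real.norm_of_nonneg hr.le]
    exact mul_le_mul_of_nonneg_left
      (pow_le_pow_of_le_one (norm_nonneg _) (by
        rw [Real.norm_eq_abs]; exact abs_besselJ_zero_le_one_holds r) hn) hr.le
  have key : ∫ t : ℂ, cexp (-(⟪t, z⟫ : ℝ) * I) * charFun (uniformWalkLaw n) t =
      ((2 * π * ∫ r in Ioi (0 : ℝ), r * besselJ 0 (r * ‖z‖) * besselJ 0 r ^ n : ℝ) : ℂ) := by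
    simp_rw [charFun_uniformWalkLaw]
    rw [← Complex.integral_comp_polarCoord_symm,
      show polarCoord.target = Ioi (0 : ℝ) ×ˢ Ioo (-π) π from rfl]
    simp only [Complex.polarCoord_symm_apply]
    rw [setIntegral_congr_fun (measurableSet_Ioi.prod measurableSet_Ioo)
      (fun p hp => polar_integrand_eq z n (mem_Ioi.1 hp.1))]
    -- Fubini on the product set
    have hint : IntegrableOn (fun p : ℝ × ℝ => ((p.1 * besselJ 0 p.1 ^ n : ℝ) : ℂ) *
        cexp (I * (((-(p.1 : ℂ) * z).re * Real.cos p.2 + (-(p.1 : ℂ) * z).im * Real.sin p.2 :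
          ℝ) : ℂ))) (Ioi (0 : ℝ) ×ˢ Ioo (-π) π) (volume.prod volume) := by
      have hg : Integrable (fun p : ℝ × ℝ => ‖p.1 * besselJ 0 p.1 ^ n‖ * (1 : ℝ))
          ((volume.restrict (Ioi (0 : ℝ))).prod (volume.restrict (Ioo (-π) π))) :=
        hrad.norm.mul_prod (integrable_const (1 : ℝ))
      rw [Measure.prod_restrict] at hg
      have hc1 : Continuous fun p : ℝ × ℝ => ((p.1 * besselJ 0 p.1 ^ n : ℝ) : ℂ) :=
        Complex.continuous_ofReal.comp
          (continuous_fst.mul (((continuous_besselJ_holds 0).comp continuous_fst).pow n))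
      have hc2 : Continuous fun p : ℝ × ℝ => cexp (I * (((-(p.1 : ℂ) * z).re * Real.cos p.2 +
          (-(p.1 : ℂ) * z).im * Real.sin p.2 : ℝ) : ℂ)) := by fun_prop
      refine Integrable.mono' hg (hc1.mul hc2).aestronglyMeasurable ?_
      refine Filter.Eventually.of_forall fun p => le_of_eq ?_
      rw [norm_mul, Complex.norm_real, mul_comm I, Complex.norm_exp_ofReal_mul_I]
    rw [show (volume : Measure (ℝ × ℝ)) = volume.prod volume from rfl, setIntegral_prod _ hint]
    have hinner : ∀ r : ℝ, ∫ θ in Ioo (-π) π, ((r * besselJ 0 r ^ n : ℝ) : ℂ) *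
        cexp (I * (((-(r : ℂ) * z).re * Real.cos θ + (-(r : ℂ) * z).im * Real.sin θ : ℝ) : ℂ)) =
        ((r * besselJ 0 r ^ n * (2 * π * besselJ 0 (r * ‖z‖)) : ℝ) : ℂ) := by
      intro r
      rw [integral_const_mul, setIntegral_Ioo_cexp_I_mul_inner]
      push_cast
      rw [norm_mul, norm_neg, Complex.norm_real, Real.norm_eq_abs]
      rcases le_or_gt 0 r with hr | hr
      · rw [abs_of_nonneg hr]
      · rw [abs_of_neg hr, show -r * ‖z‖ = -(r * ‖z‖) by ring, besselJ_neg]; simp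
    simp_rw [hinner]
    have e : ∫ r in Ioi (0 : ℝ), ((r * besselJ 0 r ^ n * (2 * π * besselJ 0 (r * ‖z‖)) : ℝ) : ℂ) =
        ((∫ r in Ioi (0 : ℝ), r * besselJ 0 r ^ n * (2 * π * besselJ 0 (r * ‖z‖)) : ℝ) : ℂ) :=
      integral_ofReal
    rw [e]
    congr 1
    rw [← integral_const_mul]
    refine setIntegral_congr_fun measurableSet_Ioi fun r _ => ?_
    ring
  rw [key, Complex.ofReal_re, ← mul_assoc]
  congr 1
  have hπ : (π : ℝ) ≠ 0 := pi_ne_zero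
  field_simp

/-- **Kluyver's formula (2.1) for `n ≥ 5`** in the source's notation: with
`p_n(x) := 2πx · f_n(x)` (the radial density of `|S_n|` for a rotation-invariant law with planar
density `f_n`), `p_n(x) = ∫₀^∞ x t J₀(xt) J₀(t)ⁿ dt` for every `x ≥ 0`.
[cite: BorweinEtAl2012, §2 eq. (2.1)] -/
theorem two_pi_mul_mul_fourierDensity_uniformWalkLaw {n : ℕ} (hn : 5 ≤ n) {x : ℝ}
    (hx : 0 ≤ x) :
    2 * π * x * fourierDensity (uniformWalkLaw n) x =
      ∫ t in Ioi (0 : ℝ), x * t * besselJ 0 (x * t) * besselJ 0 t ^ n := by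
  have hI : ∫ t in Ioi (0 : ℝ), x * t * besselJ 0 (x * t) * besselJ 0 t ^ n =
      x * ∫ t in Ioi (0 : ℝ), t * besselJ 0 (t * x) * besselJ 0 t ^ n := by
    rw [← integral_const_mul]
    refine setIntegral_congr_fun measurableSet_Ioi fun t _ => ?_
    rw [mul_comm x t]
    ring
  rw [hI, fourierDensity_uniformWalkLaw_eq hn, Complex.norm_real, Real.norm_of_nonneg hx]
  have hπ : (π : ℝ) ≠ 0 := pi_ne_zero
  field_simp

/-! ## The law of the distance `|S_n|`, `n ≥ 5` -/

/-- `f_n` is radial. [folklore] -/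
theorem fourierDensity_uniformWalkLaw_ofReal_norm {n : ℕ} (hn : 5 ≤ n) (z : ℂ) :
    fourierDensity (uniformWalkLaw n) (‖z‖ : ℂ) = fourierDensity (uniformWalkLaw n) z := by
  rw [fourierDensity_uniformWalkLaw_eq hn, fourierDensity_uniformWalkLaw_eq hn, Complex.norm_real,
    norm_norm]

/-- **The density of the distance `|S_n|` is `p_n(x) = 2πx f_n(x)` on `(0, ∞)` (`n ≥ 5`)** —
so that, with `two_pi_mul_mul_fourierDensity_uniformWalkLaw`, the radial density `p_n` of the
`n`-step walk has Kluyver's Bessel representation [BorweinEtAl2012, eq. (2.1)] for `n ≥ 5`.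
[cite: BorweinEtAl2012, §2 eq. (2.1)] -/
theorem map_norm_uniformWalkLaw {n : ℕ} (hn : 5 ≤ n) :
    (uniformWalkLaw n).map (fun z : ℂ => ‖z‖) =
      (volume.restrict (Ioi (0 : ℝ))).withDensity
        (fun x => ENNReal.ofReal (2 * π * x * fourierDensity (uniformWalkLaw n) x)) := by
  set F : ℝ → ℝ := fun x => fourierDensity (uniformWalkLaw n) x with hF
  have hint := integrable_charFun_iff.1 (integrable_charFun_uniformWalkLaw hn)
  have hFc : Continuous F :=
    (continuous_fourierDensity_uniformWalkLaw hn).comp Complex.continuous_ofReal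
  have hF0 : ∀ x, 0 ≤ F x := fun x => fourierDensity_nonneg hint _
  haveI : IsProbabilityMeasure ((uniformWalkLaw n).map fun z : ℂ => ‖z‖) :=
    Measure.isProbabilityMeasure_map continuous_norm.aemeasurable
  refine Measure.ext_of_Ioc _ _ fun a b hab => ?_
  -- the common value
  have hIntab : IntegrableOn (fun x => x * F x) (Ioc a b) :=
    ((continuous_id.mul hFc).continuousOn.integrableOn_compact isCompact_Icc).mono_set
      Ioc_subset_Icc_self
  -- right-hand side
  rw [withDensity_apply _ measurableSet_Ioc, Measure.restrict_restrict measurableSet_Ioc]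
  have hR : ∫⁻ x in Ioc a b ∩ Ioi 0, ENNReal.ofReal (2 * π * x * F x) =
      ENNReal.ofReal (∫ x in Ioc a b ∩ Ioi 0, 2 * π * x * F x) := by
    rw [ofReal_integral_eq_lintegral_ofReal]
    · refine ((hIntab.mono_set inter_subset_left).const_mul (2 * π)).congr ?_
      exact Filter.Eventually.of_forall fun x => by ring
    · refine ae_restrict_of_forall_mem (measurableSet_Ioc.inter measurableSet_Ioi) fun x hx => ?_
      have : 0 < x := hx.2
      have := hF0 x
      positivity
  rw [hR]
  -- left-hand side
  rw [Measure.map_apply continuous_norm.measurable measurableSet_Ioc,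
    uniformWalkLaw_eq_withDensity hn,
    withDensity_apply _ (measurableSet_Ioc.preimage continuous_norm.measurable)]
  set G : ℝ → ℝ := (Ioc a b).indicator fun x => F x with hG
  have hGm : ∀ z : ℂ, ((fun w : ℂ => ‖w‖) ⁻¹' Ioc a b).indicator
      (fun w => ENNReal.ofReal (fourierDensity (uniformWalkLaw n) w)) z =
      ENNReal.ofReal (G ‖z‖) := by
    intro z
    by_cases hz : ‖z‖ ∈ Ioc a b
    · rw [indicator_of_mem (show z ∈ (fun w : ℂ => ‖w‖) ⁻¹' Ioc a b from hz), hG,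
        indicator_of_mem hz, ← fourierDensity_uniformWalkLaw_ofReal_norm hn z]
    · rw [indicator_of_notMem (show z ∉ (fun w : ℂ => ‖w‖) ⁻¹' Ioc a b from hz), hG,
        indicator_of_notMem hz, ENNReal.ofReal_zero]
  rw [← lintegral_indicator (measurableSet_Ioc.preimage continuous_norm.measurable)]
  simp_rw [hGm]
  -- integrability of `G ∘ norm` on the plane
  have hGint : Integrable (fun z : ℂ => G ‖z‖) := by
    refine (integrable_fun_norm_addHaar (volume : Measure ℂ) (f := G)).2 ?_
    simp only [Complex.finrank_real_complex, Nat.add_one_sub_one, pow_one, smul_eq_mul]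
    have : (fun y : ℝ => y * G y) = (Ioc a b).indicator fun y => y * F y := by
      funext y; simp only [hG, Set.indicator_apply]; split_ifs <;> simp
    rw [this, integrableOn_indicator_iff measurableSet_Ioc]  -- hmm, IntegrableOn (indicator) ↔
    exact hIntab.mono_set inter_subset_left
  have hG0 : ∀ y, 0 ≤ G y := fun y => by
    simp only [hG, Set.indicator_apply]; split_ifs <;> simp [hF0]
  rw [← ofReal_integral_eq_lintegral_ofReal hGint (Filter.Eventually.of_forall fun z => hG0 _)]
  congr 1
  rw [integral_fun_norm_addHaar (volume : Measure ℂ) G, Complex.finrank_real_complex,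
    Measure.real, Complex.volume_ball]
  simp only [ENNReal.ofReal_one, one_pow, one_mul, ENNReal.coe_toReal, NNReal.coe_real_pi,
    Nat.add_one_sub_one, pow_one, smul_eq_mul, nsmul_eq_mul, Nat.cast_ofNat]
  have : (fun y : ℝ => y * G y) = (Ioc a b).indicator fun y => y * F y := by
    funext y; simp only [hG, Set.indicator_apply]; split_ifs <;> simp
  rw [this, integral_indicator measurableSet_Ioc, Measure.restrict_restrict measurableSet_Ioc,
    ← integral_const_mul, ← integral_const_mul]
  refine setIntegral_congr_fun ((measurableSet_Ioc (a := a) (b := b)).inter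
    (measurableSet_Ioi (a := (0 : ℝ)))) fun x _ => ?_
  ring

end Literature.Analysis.FunctionSpaces

end
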